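import Summits.Ventures.YMGap.Thresholds.OneLinkOmega
import HarnessLib

/-!
# Venture YMGap — the one-link modulus beyond first order, part 22: the SECOND MOMENT of the complex linear statistic by
# Schwinger–Dyson — the Haar fluctuation scale `1/N` instead of the Poincaré scale `1/ρ`

HONEST FRAMING: venture file of the cell `pub-ymgap` (QuantumFields programme), strong-coupling LATTICE bookkeeping for `SU(N)`
lattice Yang–Mills; nothing about the continuum or the mass gap in the Clay sense.  No number of record by itself (it feeds the
variance-refined level-two modulus `oneLinkKRModulus_levelTwoS`).

WHAT.  `ν_B(dg) ∝ exp(N Re tr(gB)) dg` on `SU(N)`, `N ≥ 1`, ANY `B`, and `z_M(g) = tr(gM)`.  The tree bounded the second moment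
`Z_M² = E_ν|z_M|²` by `(mean)² + Var`, the variance through the Bakry–Émery Poincaré inequality of `ν_B` (`Var ≤ ‖M‖_F²/ρ`,
`ρ = N(1/2 − ‖B‖_op)`; `OneLinkSecondMoments`, `OneLinkSDMeanTwo`).  Here instead the Schwinger–Dyson identity for the mixed product
(`OneLinkSDMeans.integral_reTrProdConj_eq`, adjoint Casimir `2N`):
`E_ν|tr(gM)|² = ‖M‖_F²/N + ½ ∫ Γ(Re tr(·B), |tr(·M)|²) dν_B`, whose right side is the EXACT Haar value `‖M‖_F²/N` plus a tilt
correction, and the feedback rule `OneLinkFeedback.Gam_potB_reTrProdConj`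
(`Γ = −Re[conj z_M · tr(BgMg)] + Re[conj z_M · tr(MBᴴ)]`, pointwise `|Γ| ≤ 2‖B‖_F‖M‖_F|z_M|`) give the quadratic inequality
`Z_M² ≤ ‖M‖_F²/N + ‖B‖_F‖M‖_F·Z_M`, i.e.
* `sqrt_integral_normSq_trace_le_sd`: `√(E_ν|tr(gM)|²) ≤ ‖M‖_F·(‖B‖_F/2 + √(‖B‖_F²/4 + 1/N))` — no hypothesis on `B` at all.
For `‖B‖_F ≤ √N r` this is `‖M‖_F(√N r/2 + √(N r²/4 + 1/N))` against the tree's `‖M‖_F(D_m√N r + 1/√(N(1/2−r)))`, `D_m ≥ 1`: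
at `N = 10`, `r = 0.228` the scale drops from `1.45‖M‖_F` to `0.84‖M‖_F` (cell note §5: the Monte-Carlo truth is `≈ 0.35‖M‖_F`).

References: cell note `HOME/p2/ONE-LINK-HIERARCHY.md` §4; Shen–Zhu–Zhu CMP 400 (2023) §4.1 (the Poincaré route it replaces).
-/

noncomputable section

open scoped Matrix ComplexConjugate BigOperators ContDiff Matrix.Norms.Frobenius
open Matrix Complex Finset MeasureTheory ProbabilityTheory
open Literature.MathematicalPhysics.QuantumFieldTheory
open Literature.MathematicalPhysics.QuantumFieldTheory.SUNBakryEmery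

namespace Summit.Ventures.YMGap.OneLinkEigen

variable {N : ℕ}

/-- From `Z² ≤ c + b·Z` (`Z, b ≥ 0`): `Z ≤ b/2 + √(b²/4 + c)`. [folklore] -/
theorem le_of_sq_le_add_mul {Z b c : ℝ} (h : Z ^ 2 ≤ c + b * Z) : Z ≤ b / 2 + Real.sqrt (b ^ 2 / 4 + c) := by
  have h1 : (Z - b / 2) ^ 2 ≤ b ^ 2 / 4 + c := by nlinarith only [h]
  have h2 := Real.abs_le_sqrt h1
  linarith only [h2, le_abs_self (Z - b / 2)]

/-- **Second moment of the complex linear statistic by Schwinger–Dyson**: for every `B`, `M` and `N ≥ 1`,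
`√(∫ |tr(gM)|² dν_B) ≤ ‖M‖_F · (‖B‖_F/2 + √(‖B‖_F²/4 + 1/N))` — the Haar value `‖M‖_F²/N` corrected by the tilt through the
mixed-product Schwinger–Dyson identity, instead of `(mean)² + ‖M‖_F²/ρ`. [folklore] -/
theorem sqrt_integral_normSq_trace_le_sd (hN : N ≠ 0) (B M : Matrix (Fin N) (Fin N) ℂ) :
    Real.sqrt (∫ g, ‖((g : Matrix (Fin N) (Fin N) ℂ) * M).trace‖ ^ 2
        ∂(haarProbability (SUN N)).tilted (fun g => (N : ℝ) * ((g : Matrix (Fin N) (Fin N) ℂ) * B).trace.re)) ≤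
      frobNorm M * (frobNorm B / 2 + Real.sqrt (frobNorm B ^ 2 / 4 + 1 / N)) := by
  have hNpos : (0 : ℝ) < N := Nat.cast_pos.2 (Nat.pos_of_ne_zero hN)
  have hB0 := frobNorm_nonneg B
  have hM0 := frobNorm_nonneg M
  set ν : Measure (SUN N) := (haarProbability (SUN N)).tilted (fun g => (N : ℝ) * ((g : Matrix (Fin N) (Fin N) ℂ) * B).trace.re) with hν
  have hexpi : Integrable (fun g : SUN N => Real.exp ((N : ℝ) * ((g : Matrix (Fin N) (Fin N) ℂ) * B).trace.re))
      (haarProbability (SUN N)) :=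
    integrable_of_continuous_SUN (Real.continuous_exp.comp (continuous_restrict (contDiff_pot (N : ℝ) B))) _
  haveI : IsProbabilityMeasure ν := isProbabilityMeasure_tilted hexpi
  set b : ℝ := frobNorm B * frobNorm M with hb
  have hb0 : 0 ≤ b := mul_nonneg hB0 hM0
  set S : ℝ := ∫ g, ‖((g : Matrix (Fin N) (Fin N) ℂ) * M).trace‖ ^ 2 ∂ν with hS
  have hS0 : 0 ≤ S := integral_nonneg fun g => sq_nonneg _
  set Z : ℝ := Real.sqrt S with hZ
  have hZ0 : 0 ≤ Z := Real.sqrt_nonneg _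
  have hZZ : Z ^ 2 = S := Real.sq_sqrt hS0
  have htr : Continuous fun g : SUN N => ((g : Matrix (Fin N) (Fin N) ℂ) * M).trace :=
    (continuous_subtype_val.matrix_mul continuous_const).matrix_trace
  have hzc : Continuous fun g : SUN N => ‖((g : Matrix (Fin N) (Fin N) ℂ) * M).trace‖ := continuous_norm.comp htr
  -- (1) `∫ |z| ≤ Z`
  have hintz : ∫ g, ‖((g : Matrix (Fin N) (Fin N) ℂ) * M).trace‖ ∂ν ≤ Z := by
    have h := integral_abs_le_sqrt hzc ν
    have e : (fun g : SUN N => |‖((g : Matrix (Fin N) (Fin N) ℂ) * M).trace‖|) =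
        fun g : SUN N => ‖((g : Matrix (Fin N) (Fin N) ℂ) * M).trace‖ := by
      funext g; exact abs_of_nonneg (norm_nonneg _)
    rw [e] at h
    exact h
  -- (2) the Schwinger–Dyson identity `S = ‖M‖²/N + ½ ∫ Γ`
  have hI := integral_reTrProdConj_eq hN B M M (N := N)
  rw [← hν] at hI
  have eS : S = ∫ g, (((g : Matrix (Fin N) (Fin N) ℂ) * M).trace *
      (starRingEnd ℂ) ((g : Matrix (Fin N) (Fin N) ℂ) * M).trace).re ∂ν := by
    rw [hS]
    refine integral_congr_ae (Filter.Eventually.of_forall fun g => ?_)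
    simp only [Complex.mul_conj, Complex.ofReal_re, Complex.normSq_eq_norm_sq]
  have eMM : (M * Mᴴ).trace.re = frobNorm M ^ 2 := by
    rw [frobNorm_sq_eq_re_trace, Matrix.trace_mul_comm]
  -- (3) the pointwise bound `|Γ| ≤ 2 b |z|`
  have hGam : ∀ g : SUN N,
      |Gam (pot 1 B) (fun Q : Matrix (Fin N) (Fin N) ℂ => ((Q * M).trace * (starRingEnd ℂ) (Q * M).trace).re) g| ≤
        2 * b * ‖((g : Matrix (Fin N) (Fin N) ℂ) * M).trace‖ := by
    intro g
    have hg := SUN.mem_unitaryGroup g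
    rw [Gam_potB_reTrProdConj hN B M M g]
    set z : ℂ := ((g : Matrix (Fin N) (Fin N) ℂ) * M).trace with hz
    have hw : ‖(B * (g : Matrix (Fin N) (Fin N) ℂ) * M * (g : Matrix (Fin N) (Fin N) ℂ)).trace‖ ≤ b := by
      rw [show B * (g : Matrix (Fin N) (Fin N) ℂ) * M * (g : Matrix (Fin N) (Fin N) ℂ) =
          (B * (g : Matrix (Fin N) (Fin N) ℂ)) * (M * (g : Matrix (Fin N) (Fin N) ℂ)) by simp only [Matrix.mul_assoc]]
      refine (norm_trace_mul_le _ _).trans ?_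
      rw [frobNorm_mul_unitary _ hg, frobNorm_mul_unitary _ hg]
    have hc : ‖(M * Bᴴ).trace‖ ≤ b := by
      refine (norm_trace_mul_le _ _).trans ?_
      rw [frobNorm_conjTranspose, hb, mul_comm]
    have t1 : |((starRingEnd ℂ) z * (B * (g : Matrix (Fin N) (Fin N) ℂ) * M * (g : Matrix (Fin N) (Fin N) ℂ)).trace).re| ≤ ‖z‖ * b := by
      refine (Complex.abs_re_le_norm _).trans ?_
      rw [norm_mul, Complex.norm_conj]
      exact mul_le_mul_of_nonneg_left hw (norm_nonneg _)
    have t2 : |((starRingEnd ℂ) z * (M * Bᴴ).trace).re| ≤ ‖z‖ * b := by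
      refine (Complex.abs_re_le_norm _).trans ?_
      rw [norm_mul, Complex.norm_conj]
      exact mul_le_mul_of_nonneg_left hc (norm_nonneg _)
    have e : -(1 / 2) * (((starRingEnd ℂ) z * (B * (g : Matrix (Fin N) (Fin N) ℂ) * M * (g : Matrix (Fin N) (Fin N) ℂ)).trace).re
          + ((starRingEnd ℂ) z * (B * (g : Matrix (Fin N) (Fin N) ℂ) * M * (g : Matrix (Fin N) (Fin N) ℂ)).trace).re)
        + (1 / 2) * (((starRingEnd ℂ) z * (M * Bᴴ).trace).re + ((starRingEnd ℂ) z * (M * Bᴴ).trace).re) =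
        ((starRingEnd ℂ) z * (M * Bᴴ).trace).re
          - ((starRingEnd ℂ) z * (B * (g : Matrix (Fin N) (Fin N) ℂ) * M * (g : Matrix (Fin N) (Fin N) ℂ)).trace).re := by ring
    rw [e]
    refine (abs_sub _ _).trans ?_
    linarith only [t1, t2]
  -- (4) integrate the pointwise bound
  have hGc : Continuous fun g : SUN N =>
      Gam (pot 1 B) (fun Q : Matrix (Fin N) (Fin N) ℂ => ((Q * M).trace * (starRingEnd ℂ) (Q * M).trace).re) g :=
    continuous_restrict (contDiff_Gam (contDiff_pot 1 B) (contDiff_reTrProdConj M M))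
  have iG : Integrable (fun g : SUN N =>
      Gam (pot 1 B) (fun Q : Matrix (Fin N) (Fin N) ℂ => ((Q * M).trace * (starRingEnd ℂ) (Q * M).trace).re) g) ν :=
    integrable_of_continuous_SUN hGc ν
  have iz : Integrable (fun g : SUN N => ‖((g : Matrix (Fin N) (Fin N) ℂ) * M).trace‖) ν := integrable_of_continuous_SUN hzc ν
  have hintG : |∫ g, Gam (pot 1 B) (fun Q : Matrix (Fin N) (Fin N) ℂ => ((Q * M).trace * (starRingEnd ℂ) (Q * M).trace).re) g ∂ν| ≤
      2 * b * Z := by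
    calc |∫ g, Gam (pot 1 B) (fun Q : Matrix (Fin N) (Fin N) ℂ => ((Q * M).trace * (starRingEnd ℂ) (Q * M).trace).re) g ∂ν|
        ≤ ∫ g, |Gam (pot 1 B) (fun Q : Matrix (Fin N) (Fin N) ℂ => ((Q * M).trace * (starRingEnd ℂ) (Q * M).trace).re) g| ∂ν :=
          abs_integral_le_integral_abs
      _ ≤ ∫ g, 2 * b * ‖((g : Matrix (Fin N) (Fin N) ℂ) * M).trace‖ ∂ν :=
          integral_mono iG.abs (iz.const_mul _) hGam
      _ = 2 * b * ∫ g, ‖((g : Matrix (Fin N) (Fin N) ℂ) * M).trace‖ ∂ν := integral_const_mul _ _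
      _ ≤ 2 * b * Z := mul_le_mul_of_nonneg_left hintz (by positivity)
  -- (5) the quadratic inequality and its solution
  have hquad : Z ^ 2 ≤ frobNorm M ^ 2 / N + b * Z := by
    rw [hZZ, eS, hI, eMM]
    have := (abs_le.1 hintG).2
    nlinarith only [this]
  have hsol := le_of_sq_le_add_mul hquad
  have e1 : b ^ 2 / 4 + frobNorm M ^ 2 / N = frobNorm M ^ 2 * (frobNorm B ^ 2 / 4 + 1 / N) := by rw [hb]; ring
  have e2 : Real.sqrt (frobNorm M ^ 2 * (frobNorm B ^ 2 / 4 + 1 / N)) = frobNorm M * Real.sqrt (frobNorm B ^ 2 / 4 + 1 / N) := by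
    rw [Real.sqrt_mul (by positivity), Real.sqrt_sq hM0]
  rw [e1, e2] at hsol
  calc Z ≤ b / 2 + frobNorm M * Real.sqrt (frobNorm B ^ 2 / 4 + 1 / N) := hsol
    _ = frobNorm M * (frobNorm B / 2 + Real.sqrt (frobNorm B ^ 2 / 4 + 1 / N)) := by rw [hb]; ring

end Summit.Ventures.YMGap.OneLinkEigen
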